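import Mathlib
import HarnessLib
import HarnessLib.Audit
import Summits.MatrixMultiplication.Statement
import Literature.Computability.AlgebraicComplexity.MatrixMultiplicationExponent
import Literature.Computability.AlgebraicComplexity.SchoenhageTau
import Literature.Computability.AlgebraicComplexity.ArithCircuit
import Summits.MatrixMultiplication.MatrixMultiplication.Theorems.PauliSmithLocalisationSuperquadraticInfinitelyOften
import HarnessLib.Audit.Status.Attr

/-!
Route: SuccinctSecantEquations

DORMANT since 2026-08-22T17:40:53Z (reconciler: no traction for 5.5 d (last activity item-evidence-added at 2026-08-17T04:19:47Z); parked, not closed — `ledger route dormant route-MatrixMultiplication-SuccinctSecantEquations --off` to r) — unstaffed, not closed; items shared with open routes are served there. `ledger route dormant <id> --off` reactivates.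

# Route SuccinctSecantEquations — refute omega = 2 by a SUCCINCT equation of a high secant variety;
the circuit size of the separating equation is the dial, priced by "equations of sigma_r multiply
matrices"

REFUTATION line (targets ¬MatrixMultiplication), realising idea card
secant-equations-vs-hitting-sets as the CONSTRUCTIVE
branch of its natural-proofs dichotomy. X = SUCCINCT SUPERQUADRATIC SEPARATION: there are δ > 0 and
C such that for infinitely
many n some polynomial F on ℂ^{n²}⊗ℂ^{n²}⊗ℂ^{n²} of fan-in-two circuit size ≤ n^C vanishes on every
tensor of rank ≤ r for some
r ≥ n^{2+δ} and does not vanish at ⟨n,n,n⟩. Then R(⟨n,n,n⟩) > r ≥ n^{2+δ} infinitely often, so ω(ℂ)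
≥ 2+δ > 2. X is strictly
stronger than "bR(⟨n,n,n⟩) ≥ n^{2+δ} i.o." (route BorderRankLowerBound drops succinctness): the size
of the separating equation is
the dial, dual to the Nullstellensatz-depth dial of route BrentRefutationDepth, and it is exactly
the dial on which the
hitting-set / natural-proofs dichotomy of the card (SE: low-rank tensors fool small circuits; notSE:
succinct equations exist)
decides whether the equation method can refute ω = 2 constructively at all.
Lean: `∃ δ : ℝ, 0 < δ ∧ ∃ C : ℕ, ∀ n₀ : ℕ, ∃ n : ℕ, n₀ ≤ n ∧ ∃ r : ℕ, (n : ℝ) ^ (2 + δ) ≤ r ∧ ∃ F :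
MvPolynomial ((Fin n × Fin n) × (Fin n × Fin n) × (Fin n × Fin n)) ℂ,
Literature.Computability.AlgebraicComplexity.complexity F ≤ n ^ C ∧ (∀ T : Fin n × Fin n → Fin n ×
Fin n → Fin n × Fin n → ℂ, Literature.Computability.AlgebraicComplexity.tensorRank T ≤ r →
MvPolynomial.eval (fun p => T p.1 p.2.1 p.2.2) F = 0) ∧ MvPolynomial.eval (fun p =>
Literature.Computability.AlgebraicComplexity.matMulTensor ℂ n n n p.1 p.2.1 p.2.2) F ≠ 0`

## Assembly
Pure logic (sorry-free in the folder Sketch.lean, `assembly_holds`): from SuccinctSeparation take δ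
and, for each n₀, the n, r, F; if
R(⟨n,n,n⟩) ≤ r then F(⟨n,n,n⟩) = 0 by the vanishing clause, contradiction, so n^{2+δ} ≤ r <
R(⟨n,n,n⟩) infinitely often, and
SuperquadraticInfinitelyOften concludes ¬MatrixMultiplication (succinctness is dropped here exactly
as BrentRefutationDepth drops depth:
the dial grades the certificate, the assembly only needs its soundness). The ranked cruxes are the
rungs 2m → 6m−4 → m^{1+δ} of the same
ladder on ℂ^m⊗ℂ^m⊗ℂ^m plus its price law (EquationsMultiplyMatrices) and its first hitting-set
obstruction (SparseEquationBarrier).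

Rationale: WHY THIS LINE. Every equation-based lower bound "bR(T) > r" exhibits a nonzero F in the ideal of σ_r
= σ_r(Seg(ℙ^{m−1})^{×3}) with F(T) ≠ 0; call
F succinct when its circuit size is poly(m). Algebraic natural proofs (ForbesShpilkaVolk2018,
GrochowKumarSaksSaraf2017; for tensor
varieties BlaserIkenmeyerLysikovPandeySchreyer2019, where the complexity of border-rank membership
is recorded as open, p. 7) say
succinct equations of σ_r exist iff the low-rank generator (u_i,v_i,w_i)_{i≤r} ↦ Σ u_i⊗v_i⊗w_i is
NOT a hitting-set generator for
poly(m)-size circuits; the calibration is: succinct equations are KNOWN up to r ≤ 2m − O(m/log m)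
(Koszul flattenings with
p = O(log m), LandsbergOttaviani2015), the only explicit beyond-cactus engine reaches r ≈ m
(tangency flattenings, DolezalekMichalek2026
Thm 1.1 / Cor 3.9: q(q−1)(m−2) < m³), every LINEAR rank method dies at 6m − 4 (Buczynski2026,
LinearRankMethodBarrier), and
the summit needs r = n^{2+δ} = m^{1+δ/2} at m = n². Imported from algebraic complexity / PIT: the
hitting-set dichotomy and
Andrews' lifting (Andrews2022 Thm 3 with AndrewsForbes2022 Prop 3.5: a nonzero f in the
determinantal ideal I_r border-computes
⟨r/4,r/4,r/4⟩ at 6× its multiplicative complexity), transplanted slice-by-slice to σ_r ⊃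
{(M_i)_{i≤m} : Σ rank M_i ≤ r} via the
standard monomial theory of products of determinantal rings — "equations of σ_r multiply matrices",
which prices every rung of the
ladder by ω itself; from algebraic geometry: secant vs cactus varieties. What no prior route does:
BorderRankLowerBound asks for the
bound by any means and BrentRefutationDepth grades DECOMPOSITION-side certificates; this route
grades EQUATION-side certificates,
files the first unconditional hitting-set rung (sparse equations) as a refutable statement, and
makes the SE/notSE dichotomy decidable
item by item (negatives index empty at filing).

RANKED CRUXES. #0 SuccinctSeparation (target) — X as in § Thesis: δ > 0, C, infinitely many n, r ≥
n^{2+δ}, F on (ℂ^{n²})^{⊗3} with circuit size ≤ n^C vanishing on all tensors of rank ≤ r and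
F(⟨n,n,n⟩) ≠ 0 (card: notSE branch at the ω-scale, m = n², r = m^{1+δ/2}). (why it might fail: false
if ω = 2; and even if ω > 2, SE (low-rank tensors form a hitting set for poly-size circuits at r =
m^{1+δ}) would leave only non-constructive equations — the card's dichotomy.)
[ForbesShpilkaVolk2018, BlaserIkenmeyerLysikovPandeySchreyer2019, LandsbergMichalek2018,
Buczynski2026, Blaser2013]
#2 SuperlinearSuccinctEquations (crux) — the pivot of the dichotomy (card A1, notSE): for some δ > 0
and C and infinitely many m there are r ≥ m^{1+δ} and a NONZERO polynomial F on ℂ^m⊗ℂ^m⊗ℂ^m with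
circuit size ≤ m^C vanishing on every tensor of rank ≤ r (so on σ_r; σ_r is proper since r <
⌈m³/(3m−2)⌉ forces δ < 1). Hardest and most informative: the first superlinear succinct equation of
any secant variety of a cubic format. [deps: BeyondCactusSuccinctEquations] [difficulty:
open-problem] (why it might fail: SE may hold already at r = m^{1+δ}: a hitting-set generator of
seed 3rm = N^{(2+δ)/3} against VP is plausible (FSV/GKSS heuristics, NP-hardness of tensor rank); no
equation source beyond r ≈ 2m exists today.) [ForbesShpilkaVolk2018, GrochowKumarSaksSaraf2017,
BlaserIkenmeyerLysikovPandeySchreyer2019, doi:10.1016/0196-6774(90)90014-6, DolezalekMichalek2026,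
LandsbergOttaviani2015]
#3 BeyondCactusSuccinctEquations (crux) — constructive life beyond ALL linear rank methods (card
(C)/(D) calibration): for some C and infinitely many m there are r ≥ 6m − 4 and a nonzero F on
ℂ^m⊗ℂ^m⊗ℂ^m with circuit size ≤ m^C vanishing on every tensor of rank ≤ r. Since the cactus variety
κ_{6m−4} fills the space (Buczynski2026 §1.3), no minor of a matrix of linear forms can be such an F
(LinearRankMethodBarrier.cube); σ_{6m−4} is proper for m ≥ 17. [deps: TwoMSuccinctEquations]
[difficulty: XL] (why it might fail: the only beyond-cactus engine (tangency / Kronecker–Koszul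
flattenings) is proved nontrivial at r = m only (DM26 Thm 1.1; Cor 3.9 caps the tangency flattening
at q ≲ m+1); higher Kronecker degree k may be cactus-like-bounded at O_k(m).)
[DolezalekMichalek2026, Buczynski2026, Galazka2017, GalazkaMandziukRupniewski2023,
EfremenkoGargOliveiraWigderson2018, LandsbergGCT2017]
#4 EquationsMultiplyMatrices (crux) — the card's lemma (L), secant version of Andrews' lifting:
there is an absolute constant c such that every NONZERO F on ℂ^m⊗ℂ^m⊗ℂ^m vanishing on all tensors of
rank ≤ r yields block sizes s : Fin m → ℕ with r ≤ c(m + Σ_i s_i) and bR(⊕_i ⟨s_i,s_i,s_i⟩) ≤ c ·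
(circuit size of F) — expected c = 24 from r+1 ≤ 4(Σ s_i + m) and the factor 6 of Andrews2022 Thm 3.
Proof plan: F vanishes on D_{m,r} = {(M_i): Σ_i rank M_i ≤ r} ⊂ σ_r; I(D_{m,r}) is spanned by
products of standard bideterminants whose widths sum to ≥ r+1 (DEP basis, coordinate-subspace
bookkeeping); AndrewsForbes2022 Prop 3.5 slice by slice gives a leading form ε^q α Π_i
(K_{σ(i)}|K_{σ(i)})(M_i) with Σ_i σ(i)_1 ≥ r+1; Andrews2022 Lemma 8 per slice with a COMMON δ gives
1 + δ Σ_i tr(X_iY_iZ_i) + O(δ²), s_i = ⌊σ(i)_1/4⌋; Baur–Strassen. With the τ-theorem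
(Blaser2013_thm75_holds) it prices every rung: Σ_i s_i^ω ≤ c·size(F). [difficulty: L] (why it might
fail: the single-bideterminant reduction (AF22 Prop 3.5) is proved for ONE determinantal ideal; for
the non-prime ideal ∩_ρ Σ_i I_{ρ_i+1}(M_i) the slice-wise leading forms must not cancel across
profiles, and fan-in-two size must dominate border multiplicative complexity after the
ε-substitutions.) [Andrews2022, AndrewsForbes2022, BaurStrassen1983, Blaser2013, Strassen1983]
#5 TwoMSuccinctEquations (crux) — first rung (card (C), r_succ(m) ≥ 2m?): for some C and infinitely
many m there are r ≥ 2m and a nonzero F on ℂ^m⊗ℂ^m⊗ℂ^m with circuit size ≤ m^C vanishing on every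
tensor of rank ≤ r — just beyond every Koszul flattening ((2 − 1/(p+1))m with minors of size
C(2p+1,p)·m, succinct only for p = O(log m)) and inside the window [2m, 6m−4) where linear rank
methods are not yet excluded by cactus but none is known. Implied by BeyondCactusSuccinctEquations
(Sketch.lean, m ≥ 1). [difficulty: L] (why it might fail: explicit tensors with bR ≥ 2.02m exist
only via border substitution (LandsbergMichalek2019Haystack), whose implicit equations are
eliminants, not succinct; Kronecker–Koszul flattenings of degree k ≥ 2 may all saturate below 2m.)
[LandsbergOttaviani2015, LandsbergMichalek2019Haystack, DolezalekMichalek2026,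
EfremenkoGargOliveiraWigderson2018]
#6 SparseEquationBarrier (crux) — the NEGATIVE side, first unconditional hitting-set rung (card A2,
weak-class SE): for every C, for all large m, every r ≥ m and every F on ℂ^m⊗ℂ^m⊗ℂ^m with at most
m^C monomials that vanishes on all tensors of rank ≤ r is the zero polynomial (poly-sparse
polynomials cannot be equations of σ_r, r ≥ m). Known ingredients: every monomial of an equation of
σ_r involves ≥ r+1 coordinates; torus-weight components of an equation are equations; no binomial
vanishes on σ_2 (UFD on Π(u_a v_b w_c + u'_a v'_b w'_c)). Filed ranked so that refuters (find a
sparse equation) and provers (FSV-style sparse-PIT against low-rank points) are both staffed; its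
proof would be the first theorem-grade piece of the card's SuccinctEquationBarrier. [difficulty: L]
(why it might fail: nobody has lower-bounded monomial counts in I(σ_r) beyond degree ≥ r+1; a sparse
equation of huge degree supported on a hyper-generic coordinate configuration is not excluded by
weight or UFD arguments (binomials are, trinomials are not).) [ForbesShpilkaVolk2018,
ChatterjeeKumarRamyaSaptharishiTengse2020, KumarVolk2022, LandsbergGCT2017]
#9 SuperquadraticInfinitelyOften (support) — glue (provable now): an infinitely-often superquadratic
rank lower bound n^{2+δ} < R(⟨n,n,n⟩) (δ > 0 fixed) contradicts ω(ℂ) = 2 (if sInf = 2 then 2+δ/2 is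
admissible by csInf_lt_iff + upward closure, so R = O(n^{2+δ/2}); nonempty by
three_mem_admissibleExponents; if not BddBelow the sInf is junk 0 ≠ 2). [difficulty: provable-now]
[Blaser2013]
#9 LinearScaleSuccinctEquations (support) — calibration floor (card (C): "SE is false at linear
scale"): for every ε > 0 there is C such that for all large m some nonzero F on ℂ^m⊗ℂ^m⊗ℂ^m of
circuit size ≤ m^C vanishes on all tensors of rank ≤ r for some r ≥ (2−ε)m — Koszul flattening
minors Λ^p A'⊗B* → Λ^{p+1} A'⊗C over a (2p+1)-plane A', p = ⌈2/ε⌉ (LandsbergOttaviani2015 §2–4, Cor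
1.2 at ⟨n,n,n⟩; LandsbergGCT2017 §2.4: rank ≤ r·C(2p,p) on σ_r against C(2p+1,p)·m generically),
computed by division-free determinant circuits (DetInVP). [difficulty: M] [LandsbergOttaviani2015,
LandsbergGCT2017]

TWO-LAYER PLAN. Foreseen glued splits (none filed now, k ≤ 3, depth 1): EquationsMultiplyMatrices ⇐
SliceStraightening (AF22 Prop 3.5 for the product
ideal ∩_ρ Σ_i I_{ρ_i+1}(M_i): leading form a product of bideterminants with widths summing to ≥ r+1)
→ TraceGadgetDirectSum (Andrews
Lemma 8 with a common δ + Baur–Strassen: bR(⊕⟨s_i⟩) ≤ 6 × border multiplicative complexity) →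
EquationsMultiplyMatrices;
BeyondCactusSuccinctEquations ⇐ KKRankOnSecant (a Kronecker–Koszul flattening Φ of Kronecker degree
k with rank ≤ g(r) on σ_r and
poly(m) size) → KKRankExceeded (some tensor with rank Φ > g(6m−4)) → BeyondCactusSuccinctEquations;
SparseEquationBarrier ⇐
WeightReduction (torus-weight components, sparsity non-increasing) → LowRankSeparation (an s-sparse
weight vector of support-width
≥ r+1 is nonzero at some rank-≤ r point when r ≥ m) → SparseEquationBarrier.

KILL CRITERIA. ω = 2 proved by any positive route refutes SuccinctSeparation outright: close
`refuted:SuccinctSeparation`. A hitting-set theorem for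
poly-size CIRCUITS at every superlinear scale (¬SuperlinearSuccinctEquations: for all δ, C, large m,
no nonzero size-m^C F vanishes on
σ_{m^{1+δ}}) kills the target too (it needs r = m^{1+δ/2} at m = n²): close
`refuted:SuperlinearSuccinctEquations` and hand the theorem
to Literature/Barriers as SuccinctEquationBarrier (the card's export (a)); route
BorderRankLowerBound then re-stages its rank-3 crux as
NON-constructive. SE proved only for formulas/ABPs (determinantal complexity) or only for
sparse/ROABP classes: not a kill — record the
barrier, keep the circuit-size target. ¬BeyondCactusSuccinctEquations (a Gałązka-type theorem: every
poly-size equation vanishes on a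
cactus-like variety filling at O(m)) is equivalent in effect to the circuit-SE kill.
SparseEquationBarrier refuted (a poly-sparse
equation at r ≥ m) is a discovery feeding TwoM/BeyondCactus, not a kill. EquationsMultiplyMatrices
refuted only removes the price law.

NOT DECOMPOSED YET. The evaluation step at ⟨n,n,n⟩ (F(⟨n,n,n⟩) ≠ 0 for a superlinear F) — a child of
the target only after SuperlinearSuccinctEquations
closes; determinantal-complexity / formula variants of every rung (dc exists in the tree; filed
later if refuters want the ABP class);
NP-hardness of border-rank membership (card A5; would give the BILPS conditional barrier for σ_r
directly) — recorded, not staffed; the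
succinctness census of the ledger's other refutation engines (card A4: HWV obstructions non-succinct
hence unbarred, border apolarity
exhibits no equation, Brent-system SOS is a different proof system) — prose for the tenure pass; the
constant c (expected 24) and the
D_{m,r}-generality of EquationsMultiplyMatrices; kit computations of Kronecker–Koszul flattening
ranks at r ∈ [2m, 6m] for m ≤ 8 —
requested by provers/refuters of TwoM, not here.

CHEAPEST FALSIFIER. Arithmetic done here: DM26 Cor 3.9 needs q(q−1)(m−2) < m³ (the tangency
flattening maps into V₁*⊗V₂⊗V₃ of dimension m³), so the
tangency flattening itself certifies only q ≲ m+1 and cannot serve TwoM — the engine for ranks 5/3/2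
must be a Kronecker–Koszul or
Kronecker–Young flattening of Kronecker degree k ≥ 2 with a better dimension/F(q) ratio, or a
non-flattening circuit. Cheapest
next check (kit, minutes): for m = 4..7 and the k = 2, 3 Kronecker–Koszul flattenings of DM26 §3,
compare rank on random rank-r tensors
with rank on a random tensor for r = 2m..3m; if every such flattening is already saturated at r = 2m
the constructive ladder has no
engine above the Koszul line and ranks 5/3/2 go dormant behind EquationsMultiplyMatrices and
SparseEquationBarrier. Cheapest lookup:
a Gałązka-type statement for NONLINEAR (polynomial) vector-bundle equations in Galazka2017 /
Buczynski2026 §1.5–1.6 — Buczyński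
records the question as open ("so far all the lower bounds … seem to also be bounds on border cactus
rank").

NUMBERS. Generic border rank of ℂ^m⊗ℂ^m⊗ℂ^m: ⌈m³/(3m−2)⌉ ≈ m²/3 (so σ_{6m−4} is proper iff m ≥ 17).
Cactus fill / linear-rank-method cap:
6m − 4 (Buczynski2026 Thm 2, §1.3); EGOW rank-method cap 8m (EfremenkoGargOliveiraWigderson2018 Thm
4.4). Succinct Koszul reach:
(2 − 1/(p+1))m with minors of size C(2p+1,p)·m, i.e. r_succ(m) ≥ 2m − O(m/log m)
(LandsbergOttaviani2015). Beyond-cactus explicit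
equations: σ_m only, minors of size m(m−1)(m−2)+1 of a quadratic flattening, degree 2(m(m−1)(m−2)+1)
= 4370 at m = 14 in 2744
variables (DolezalekMichalek2026 Thm 1.1). Matrix case: any nonzero f ∈ I^det_r has border
multiplicative complexity ≥ bR(⟨r/4⟩)/6
≥ r²/48 − (log₂ r)/6 + 1/6 (Andrews2022 Thm 3, Cor 1). At ⟨n,n,n⟩ (m = n²): bR ≥ 2n² − ⌈log₂ n⌉ − 1
(LandsbergMichalek2018),
bR ≥ 2n² − n by Koszul (LandsbergOttaviani2015), bR(⟨2,2,2⟩) = 7, bR(⟨3,3,3⟩) ∈ [17, 20]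
(ConnerHarperLandsberg2023); the target
needs r ≥ n^{2+δ}. Price law (EquationsMultiplyMatrices + τ-theorem): a size-m^{1+κ} equation of
σ_{m^{1+δ}} forces
m·(m^δ/c)^ω ≤ c·m^{1+κ}, i.e. ω ≤ κ/δ + o(1) — cheap equations at high secant level would themselves
be fast matrix multiplication.
Items at open: 9 (1 target, 5 cruxes, 2 support, 1 assembly).

DEFINITION REQUESTS. None: `complexity` (fan-in-two circuit size, ArithCircuit.lean),
`determinantalComplexity`, `tensorRank`, `matMulTensor`,
`algBorderRank`, `matMulDirectSum` (SchoenhageTau.lean) and `Blaser2013_thm75_holds` (τ-theorem,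
proved) exist. Cite facts wanted
(filed after open as `--kind cite`): Andrews2022 Lemma 8 + Thm 3 (trace-ABP gadget; bR(⟨r/4⟩) ≤ 6 ×
border multiplicative complexity
of any nonzero f ∈ I^det_{n,m,r}); AndrewsForbes2022 Prop 3.5 (reduction of f ∈ I^det_r to a single
bideterminant of width ≥ r under a
border-linear change of variables); ForbesShpilkaVolk2018 main theorem (succinct hitting sets ⟺ no
succinct equations) for the
barrier write-up.

Novelty: Searches (2026-08-15): `lit search "Ideals determinants straightening …"` (local 8, zbmath/crossref:
AF22 = arXiv:2112.00792);
`lit search --hybrid "succinct hitting sets barriers lower bounds algebraic circuits natural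
proofs"` (10 book hits, none on secant
varieties); `lit search "variety membership testing algebraic natural proofs geometric complexity
theory"` (10 local papers: BILPS19,
CKRST20 arXiv:2004.14147, KRST22 arXiv:2012.07056, KumarVolk2022, …); `lit galaxy search --star all`
× 4 ("succinct hitting sets": 2
hits — EGOW arXiv:1710.09502, LNCS 10846; "equations for secant varieties": 11 hits — Landsberg's
2022 Trieste survey
doi:10.13137/2464-8728/34006, LandsbergGCT2017, Abo–Ottaviani–Peterson; "algebraic natural proofs":
6; "complexity of equations of
secant": 0); `lit frontier MatrixMultiplication --since 2022` (30 rows; relevant: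
DolezalekMichalek2026 arXiv:2602.12762);
`lit read` of arXiv:2208.01078 pp. 9–11, arXiv:2112.00792 p. 21, arXiv:2602.12762 pp. 2–9,
arXiv:1911.02534 (grep), arXiv:2004.14147
p. 2; `ledger negatives --problem MatrixMultiplication` (0). OpenAlex/S2/arXiv APIs were
rate-limited (429) during the session — audit
flag: a 2023–2026 paper on hitting sets from low-rank tensors or on the circuit complexity of
secant-variety equations could exist unseen.
Nearest prior art found: Andrews2022 (arXiv:2208.01078, Thm 3) and AndrewsForbes2022
(arXiv:2112.00792, Prop 3.5) — the lifting for
the MATRIX determinantal ideal; BlaserIkenmeyerLysikovPandeySch  [refs: 10.13137/2464-8728/34006, 2112.00792, 2004.14147, 2012.07056, 1710.09502, 2602.12762, 2208.01078, 1911.02534, doi:10.13137/2464-8728/34006, KumarVolk2022, LandsbergGCT2017, DolezalekMichalek2026, Andrews2022, AndrewsForbes2022, BlaserIkenmeyerLysikovPandeySchreyer2019, ForbesShpilkaVolk2018, GrochowKumarSaksSaraf2017, ChatterjeeKumarRamyaSaptharishiTengse2020]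

Barriers (technique_class: succinct-equations, natural-proofs, nonlinear-flattening): - technique_class: succinct-equations, natural-proofs, nonlinear-flattening,
secant-variety-equations, border-rank-lower-bound
- Literature.Barriers.MatrixMultiplication.LinearRankMethodBarrier: APPLIES to the naive engine and
is built into the ladder — ranks 3 and 2 and the target demand equations at r ≥ 6m − 4 (resp.
m^{1+δ}, n^{2+δ} = far above 6n² − 4 at ⟨n,n,n⟩, `.matMul`), where Buczynski2026 Thm 2
(`Buczynski2026_cactusBarrier_segre.cube`) and EGOW2018 Thm 4.4 exclude every minor of a matrix of
linear forms; any witness is therefore a NONLINEAR flattening (DolezalekMichalek2026, the catalogued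
evasion (ii)) or a non-flattening circuit; rank 5 (r ≥ 2m) deliberately sits inside the window [2m,
6m−4) where the barrier does not bite but no linear method is known either.
- Literature.Barriers.MatrixMultiplication.InfimumNotMinimumBarrier: not met — the target is an
infinitely-often lower bound R(⟨n,n,n⟩) > n^{2+δ}, which bounds the infimum ω from below without any
attained-exponent assumption.
- Literature.Barriers.MatrixMultiplication.IrreversibilityBarrier, UniversalMethodBarrier,
UnstableTensorBarrier, RectangularBarrier, EquivoluminousBarrier, TricoloredSumFreeBarrier,
NilpotentGroupBarrier, QuasirandomBarrier, NormalizerBarrier, YoungSubgroupBarrier: upper-bound-side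
(algorithm-design) barriers; this is a lower-bound line, neither used nor in conflict.
- Proposed (not catalogued) SuccinctEquationBarrier = hitting-set property of low-rank tensors
against poly-size circu

Novelty grade: new-combination — ROUTE REVIEW refuter rreview-5bc268af 2026-08-15 — KEEP OPEN, 2 objections (full text: my folder note_MM.txt). O1 (operational, blocks provers): route file Theses/SuccinctSecantEquations.lean NOT materialised (rev 0, commit '-'; opened 12:22:16Z before the 12:25Z gate restart — same lost route-open  (refuter refuter-rreview-route-AtomisticToContinu-5bc268af-0, 2026-08-15T14:05:09Z; prior: Andrews2022 arXiv:2208.01078 Thm 3, AndrewsForbes2022 arXiv:2112.00792 Prop 3.5, BlaserIkenmeyerLysikovPandeySchreyer2019 arXiv:1911.02534, ForbesShpilkaVolk2018, LandsbergOttaviani2015, DolezalekMichalek2026 arXiv:2602.12762, doi:10.13137/2464-8728/34006, route-MatrixMultiplication-DeterminantalIdealExponent AndrewsLifting)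

History (route lifecycle, newest last):
- 2026-08-16T04:11:26Z · AUTO-CRUX (backfill): SuccinctSeparation — hypotheses of the deciding theorem that nothing in the route derives are cruxes (operator:999:1085951)
- 2026-08-22T17:40:53Z · DORMANT — reconciler: no traction for 5.5 d (last activity item-evidence-added at 2026-08-17T04:19:47Z); parked, not closed — `ledger route dormant route-MatrixMultiplica (operator:999:1913569)

sub-problem: MatrixMultiplication · status: dormant · opened planner-plancard-MatrixMultiplication-MatrixM-4953a708-0 2026-08-15T12:22:16Z · rev 1 · ledger route-MatrixMultiplication-SuccinctSecantEquations
GENERATED by the gate from the ledger (D-0016/17). Provers cite these decls: `theorem foo : Summit.MatrixMultiplication.MatrixMultiplication.Theses.SuccinctSecantEquations.<Decl> := …` in Summits/MatrixMultiplication/MatrixMultiplication/Theorems/<Name>.lean.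
-/

namespace Summit.MatrixMultiplication.MatrixMultiplication.Theses.SuccinctSecantEquations

open scoped BigOperators Topology Manifold Classical MeasureTheory ProbabilityTheory Matrix InnerProductSpace ComplexConjugate ContinuousMap
open Filter Set Function TopologicalSpace MeasureTheory

attribute [summit_statement] _root_.MatrixMultiplication

/-- item stmt-MatrixMultiplication-7986 · crux (kind.auto-crux: conjecture-grade) · rank 0 · open · by planner
why it might fail: false if ω = 2; and even if ω > 2, SE (low-rank tensors form a hitting set for poly-size circuits at r = m^{1+δ}) would leave only non-constructive equations — the card's dichotomy.
sources: ForbesShpilkaVolk2018, BlaserIkenmeyerLysikovPandeySchreyer2019, LandsbergMichalek2018, Buczynski2026, Blaser2013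
[target] X as in § Thesis: δ > 0, C, infinitely many n, r ≥ n^{2+δ}, F on (ℂ^{n²})^{⊗3} with circuit
size ≤ n^C vanishing on all tensors of rank ≤ r and F(⟨n,n,n⟩) ≠ 0 (card: notSE branch at the
ω-scale, m = n², r = m^{1+δ/2}). -/
@[route_item "route-MatrixMultiplication-SuccinctSecantEquations", crux]
def SuccinctSeparation : Prop :=
  ∃ δ : ℝ, 0 < δ ∧ ∃ C : ℕ, ∀ n₀ : ℕ, ∃ n : ℕ, n₀ ≤ n ∧ ∃ r : ℕ, (n : ℝ) ^ (2 + δ) ≤ r ∧ ∃ F : MvPolynomial ((Fin n × Fin n) × (Fin n × Fin n) × (Fin n × Fin n)) ℂ, Literature.Computability.AlgebraicComplexity.complexity F ≤ n ^ C ∧ (∀ T : Fin n × Fin n → Fin n × Fin n → Fin n × Fin n → ℂ, Literature.Computability.AlgebraicComplexity.tensorRank T ≤ r → MvPolynomial.eval (fun p => T p.1 p.2.1 p.2.2) F = 0) ∧ MvPolynomial.eval (fun p => Literature.Computability.AlgebraicComplexity.matMulTensor ℂ n n n p.1 p.2.1 p.2.2) F ≠ 0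

/-- item stmt-MatrixMultiplication-7987 · crux · rank 2 · open · by planner
why it might fail: SE may hold already at r = m^{1+δ}: a hitting-set generator of seed 3rm = N^{(2+δ)/3} against VP is plausible (FSV/GKSS heuristics, NP-hardness of tensor rank); no equation source beyond r ≈ 2m exists today.
sources: ForbesShpilkaVolk2018, GrochowKumarSaksSaraf2017, BlaserIkenmeyerLysikovPandeySchreyer2019, doi:10.1016/0196-6774(90)90014-6, DolezalekMichalek2026, LandsbergOttaviani2015
[crux] the pivot of the dichotomy (card A1, notSE): for some δ > 0 and C and infinitely many m there
are r ≥ m^{1+δ} and a NONZERO polynomial F on ℂ^m⊗ℂ^m⊗ℂ^m with circuit size ≤ m^C vanishing on every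
tensor of rank ≤ r (so on σ_r; σ_r is proper since r < ⌈m³/(3m−2)⌉ forces δ < 1). Hardest and most
informative: the first superlinear succinct equation of any secant variety of a cubic format. [deps:
BeyondCactusSuccinctEquations] [difficulty: open-problem] -/
@[route_item "route-MatrixMultiplication-SuccinctSecantEquations"]
def SuperlinearSuccinctEquations : Prop :=
  ∃ δ : ℝ, 0 < δ ∧ ∃ C : ℕ, ∀ m₀ : ℕ, ∃ m : ℕ, m₀ ≤ m ∧ ∃ r : ℕ, (m : ℝ) ^ (1 + δ) ≤ r ∧ ∃ F : MvPolynomial (Fin m × Fin m × Fin m) ℂ, F ≠ 0 ∧ Literature.Computability.AlgebraicComplexity.complexity F ≤ m ^ C ∧ ∀ T : Fin m → Fin m → Fin m → ℂ, Literature.Computability.AlgebraicComplexity.tensorRank T ≤ r → MvPolynomial.eval (fun p => T p.1 p.2.1 p.2.2) F = 0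

/-- item stmt-MatrixMultiplication-7988 · crux · rank 3 · open · by planner
why it might fail: the only beyond-cactus engine (tangency / Kronecker–Koszul flattenings) is proved nontrivial at r = m only (DM26 Thm 1.1; Cor 3.9 caps the tangency flattening at q ≲ m+1); higher Kronecker degree k may be cactus-like-bounded at O_k(m).
sources: DolezalekMichalek2026, Buczynski2026, Galazka2017, GalazkaMandziukRupniewski2023, EfremenkoGargOliveiraWigderson2018, LandsbergGCT2017
[crux] constructive life beyond ALL linear rank methods (card (C)/(D) calibration): for some C and
infinitely many m there are r ≥ 6m − 4 and a nonzero F on ℂ^m⊗ℂ^m⊗ℂ^m with circuit size ≤ m^C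
vanishing on every tensor of rank ≤ r. Since the cactus variety κ_{6m−4} fills the space
(Buczynski2026 §1.3), no minor of a matrix of linear forms can be such an F
(LinearRankMethodBarrier.cube); σ_{6m−4} is proper for m ≥ 17. [deps: TwoMSuccinctEquations]
[difficulty: XL] -/
@[route_item "route-MatrixMultiplication-SuccinctSecantEquations"]
def BeyondCactusSuccinctEquations : Prop :=
  ∃ C : ℕ, ∀ m₀ : ℕ, ∃ m : ℕ, m₀ ≤ m ∧ ∃ r : ℕ, 6 * m - 4 ≤ r ∧ ∃ F : MvPolynomial (Fin m × Fin m × Fin m) ℂ, F ≠ 0 ∧ Literature.Computability.AlgebraicComplexity.complexity F ≤ m ^ C ∧ ∀ T : Fin m → Fin m → Fin m → ℂ, Literature.Computability.AlgebraicComplexity.tensorRank T ≤ r → MvPolynomial.eval (fun p => T p.1 p.2.1 p.2.2) F = 0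

/-- item stmt-MatrixMultiplication-7989 · crux · rank 4 · open · by planner
why it might fail: the single-bideterminant reduction (AF22 Prop 3.5) is proved for ONE determinantal ideal; for the non-prime ideal ∩_ρ Σ_i I_{ρ_i+1}(M_i) the slice-wise leading forms must not cancel across profiles, and fan-in-two size must dominate border multiplicative complexity after the ε-substitutions.
sources: Andrews2022, AndrewsForbes2022, BaurStrassen1983, Blaser2013, Strassen1983
[crux] the card's lemma (L), secant version of Andrews' lifting: there is an absolute constant c
such that every NONZERO F on ℂ^m⊗ℂ^m⊗ℂ^m vanishing on all tensors of rank ≤ r yields block sizes s :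
Fin m → ℕ with r ≤ c(m + Σ_i s_i) and bR(⊕_i ⟨s_i,s_i,s_i⟩) ≤ c · (circuit size of F) — expected c =
24 from r+1 ≤ 4(Σ s_i + m) and the factor 6 of Andrews2022 Thm 3. Proof plan: F vanishes on D_{m,r}
= {(M_i): Σ_i rank M_i ≤ r} ⊂ σ_r; I(D_{m,r}) is spanned by products of standard bideterminants
whose widths sum to ≥ r+1 (DEP basis, coordinate-subspace bookkeeping); AndrewsForbes2022 Prop 3.5
slice by slice gives a leading form ε^q α Π_i (K_{σ(i)}|K_{σ(i)})(M_i) with Σ_i σ(i)_1 ≥ r+1;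
Andrews2022 Lemma 8 per slice with a COMMON δ gives 1 + δ Σ_i tr(X_iY_iZ_i) + O(δ²), s_i =
⌊σ(i)_1/4⌋; Baur–Strassen. With the τ-theorem (Blaser2013_thm75_holds) it prices every rung: Σ_i
s_i^ω ≤ c·size(F). [difficulty: L] -/
@[route_item "route-MatrixMultiplication-SuccinctSecantEquations"]
def EquationsMultiplyMatrices : Prop :=
  ∃ c : ℕ, 0 < c ∧ ∀ (m r : ℕ) (F : MvPolynomial (Fin m × Fin m × Fin m) ℂ), F ≠ 0 → (∀ T : Fin m → Fin m → Fin m → ℂ, Literature.Computability.AlgebraicComplexity.tensorRank T ≤ r → MvPolynomial.eval (fun p => T p.1 p.2.1 p.2.2) F = 0) → ∃ s : Fin m → ℕ, r ≤ c * (m + ∑ i, s i) ∧ Literature.Computability.AlgebraicComplexity.algBorderRank (Literature.Computability.AlgebraicComplexity.matMulDirectSum ℂ s s s) ≤ c * Literature.Computability.AlgebraicComplexity.complexity F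

/-- item stmt-MatrixMultiplication-7990 · crux · rank 5 · open · by planner
why it might fail: explicit tensors with bR ≥ 2.02m exist only via border substitution (LandsbergMichalek2019Haystack), whose implicit equations are eliminants, not succinct; Kronecker–Koszul flattenings of degree k ≥ 2 may all saturate below 2m.
sources: LandsbergOttaviani2015, LandsbergMichalek2019Haystack, DolezalekMichalek2026, EfremenkoGargOliveiraWigderson2018
[crux] first rung (card (C), r_succ(m) ≥ 2m?): for some C and infinitely many m there are r ≥ 2m and
a nonzero F on ℂ^m⊗ℂ^m⊗ℂ^m with circuit size ≤ m^C vanishing on every tensor of rank ≤ r — just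
beyond every Koszul flattening ((2 − 1/(p+1))m with minors of size C(2p+1,p)·m, succinct only for p
= O(log m)) and inside the window [2m, 6m−4) where linear rank methods are not yet excluded by
cactus but none is known. Implied by BeyondCactusSuccinctEquations (Sketch.lean, m ≥ 1).
[difficulty: L] -/
@[route_item "route-MatrixMultiplication-SuccinctSecantEquations"]
def TwoMSuccinctEquations : Prop :=
  ∃ C : ℕ, ∀ m₀ : ℕ, ∃ m : ℕ, m₀ ≤ m ∧ ∃ r : ℕ, 2 * m ≤ r ∧ ∃ F : MvPolynomial (Fin m × Fin m × Fin m) ℂ, F ≠ 0 ∧ Literature.Computability.AlgebraicComplexity.complexity F ≤ m ^ C ∧ ∀ T : Fin m → Fin m → Fin m → ℂ, Literature.Computability.AlgebraicComplexity.tensorRank T ≤ r → MvPolynomial.eval (fun p => T p.1 p.2.1 p.2.2) F = 0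

/-- item stmt-MatrixMultiplication-7991 · crux · rank 6 · open · by planner
why it might fail: nobody has lower-bounded monomial counts in I(σ_r) beyond degree ≥ r+1; a sparse equation of huge degree supported on a hyper-generic coordinate configuration is not excluded by weight or UFD arguments (binomials are, trinomials are not).
sources: ForbesShpilkaVolk2018, ChatterjeeKumarRamyaSaptharishiTengse2020, KumarVolk2022, LandsbergGCT2017
[crux] the NEGATIVE side, first unconditional hitting-set rung (card A2, weak-class SE): for every
C, for all large m, every r ≥ m and every F on ℂ^m⊗ℂ^m⊗ℂ^m with at most m^C monomials that vanishes
on all tensors of rank ≤ r is the zero polynomial (poly-sparse polynomials cannot be equations of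
σ_r, r ≥ m). Known ingredients: every monomial of an equation of σ_r involves ≥ r+1 coordinates;
torus-weight components of an equation are equations; no binomial vanishes on σ_2 (UFD on Π(u_a v_b
w_c + u'_a v'_b w'_c)). Filed ranked so that refuters (find a sparse equation) and provers
(FSV-style sparse-PIT against low-rank points) are both staffed; its proof would be the first
theorem-grade piece of the card's SuccinctEquationBarrier. [difficulty: L] -/
@[route_item "route-MatrixMultiplication-SuccinctSecantEquations"]
def SparseEquationBarrier : Prop :=
  ∀ C : ℕ, ∀ᶠ m : ℕ in Filter.atTop, ∀ r : ℕ, m ≤ r → ∀ F : MvPolynomial (Fin m × Fin m × Fin m) ℂ, F.support.card ≤ m ^ C → (∀ T : Fin m → Fin m → Fin m → ℂ, Literature.Computability.AlgebraicComplexity.tensorRank T ≤ r → MvPolynomial.eval (fun p => T p.1 p.2.1 p.2.2) F = 0) → F = 0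

/-- item stmt-MatrixMultiplication-7992 · support · rank 9 · closed · proved by Summit.MatrixMultiplication.MatrixMultiplication.Theorems.superquadraticInfinitelyOften_proof @ 02436f954f72 (prover) · by planner
sources: Blaser2013
[support] glue (provable now): an infinitely-often superquadratic rank lower bound n^{2+δ} <
R(⟨n,n,n⟩) (δ > 0 fixed) contradicts ω(ℂ) = 2 (if sInf = 2 then 2+δ/2 is admissible by csInf_lt_iff
+ upward closure, so R = O(n^{2+δ/2}); nonempty by three_mem_admissibleExponents; if not BddBelow
the sInf is junk 0 ≠ 2). [difficulty: provable-now] -/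
@[route_item "route-MatrixMultiplication-SuccinctSecantEquations", crux]
def SuperquadraticInfinitelyOften : Prop :=
  (∃ δ : ℝ, 0 < δ ∧ ∀ n₀ : ℕ, ∃ n : ℕ, n₀ ≤ n ∧ (n : ℝ) ^ (2 + δ) < (Literature.Computability.AlgebraicComplexity.tensorRank (Literature.Computability.AlgebraicComplexity.matMulTensor ℂ n n n) : ℝ)) → ¬ MatrixMultiplication

/-- `SuperquadraticInfinitelyOften` holds: proved by `Summit.MatrixMultiplication.MatrixMultiplication.Theorems.superquadraticInfinitelyOften_proof` @ 02436f954f72. -/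
theorem SuperquadraticInfinitelyOften_holds : SuperquadraticInfinitelyOften := _root_.Summit.MatrixMultiplication.MatrixMultiplication.Theorems.superquadraticInfinitelyOften_proof

/-- item stmt-MatrixMultiplication-7993 · support · rank 9 · open · by planner
sources: LandsbergOttaviani2015, LandsbergGCT2017
[support] calibration floor (card (C): "SE is false at linear scale"): for every ε > 0 there is C
such that for all large m some nonzero F on ℂ^m⊗ℂ^m⊗ℂ^m of circuit size ≤ m^C vanishes on all
tensors of rank ≤ r for some r ≥ (2−ε)m — Koszul flattening minors Λ^p A'⊗B* → Λ^{p+1} A'⊗C over a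
(2p+1)-plane A', p = ⌈2/ε⌉ (LandsbergOttaviani2015 §2–4, Cor 1.2 at ⟨n,n,n⟩; LandsbergGCT2017 §2.4:
rank ≤ r·C(2p,p) on σ_r against C(2p+1,p)·m generically), computed by division-free determinant
circuits (DetInVP). [difficulty: M] -/
@[route_item "route-MatrixMultiplication-SuccinctSecantEquations"]
def LinearScaleSuccinctEquations : Prop :=
  ∀ ε : ℝ, 0 < ε → ∃ C : ℕ, ∀ᶠ m : ℕ in Filter.atTop, ∃ r : ℕ, (2 - ε) * (m : ℝ) ≤ r ∧ ∃ F : MvPolynomial (Fin m × Fin m × Fin m) ℂ, F ≠ 0 ∧ Literature.Computability.AlgebraicComplexity.complexity F ≤ m ^ C ∧ ∀ T : Fin m → Fin m → Fin m → ℂ, Literature.Computability.AlgebraicComplexity.tensorRank T ≤ r → MvPolynomial.eval (fun p => T p.1 p.2.1 p.2.2) F = 0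

/-- item stmt-MatrixMultiplication-7994 · assembly · rank 1 · open · by planner
sources: Blaser2013, Andrews2022
[assembly] SuccinctSeparation → SuperquadraticInfinitelyOften → ¬MatrixMultiplication. -/
@[route_item "route-MatrixMultiplication-SuccinctSecantEquations"]
def Assembly : Prop :=
  SuccinctSeparation → SuperquadraticInfinitelyOften → ¬ MatrixMultiplication

/-! D-0027 §2.1 — DECIDING THEOREM (planner-authored via `route open/edit --closes-file`; by planner-rbadge-MatrixMultiplication-SuccinctSe-02824857-g2-0 2026-08-15T16:11:33Z):
its hypotheses are this route's items and its conclusion the sub-problem Statement (glue_lint), and it elaborates with this file. -/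

@[closes "route-MatrixMultiplication-SuccinctSecantEquations"] theorem closes : SuccinctSeparation → SuperquadraticInfinitelyOften → ¬ MatrixMultiplication := by
  -- Route glue (D-0027 §2.1, refutation line). From SuccinctSeparation take δ > 0 (and C); for
  -- every n₀ it yields n ≥ n₀, r with n^(2+δ) ≤ r and an F vanishing on every tensor of rank ≤ r
  -- but not at ⟨n,n,n⟩; hence ¬ (R(⟨n,n,n⟩) ≤ r), i.e. n^(2+δ) ≤ r < R(⟨n,n,n⟩) — exactly the
  -- hypothesis of the shared support item SuperquadraticInfinitelyOften, which refutes ω(ℂ) = 2.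
  -- (Succinctness `complexity F ≤ n^C` grades the certificate; soundness does not use it.)
  rintro ⟨δ, hδ, C, hC⟩ hS
  refine hS ⟨δ, hδ, fun n₀ => ?_⟩
  obtain ⟨n, hn, r, hr, F, -, hvan, hne⟩ := hC n₀
  refine ⟨n, hn, hr.trans_lt ?_⟩
  have hlt : r < Literature.Computability.AlgebraicComplexity.tensorRank
      (Literature.Computability.AlgebraicComplexity.matMulTensor ℂ n n n) := by
    by_contra hle
    exact hne (hvan (Literature.Computability.AlgebraicComplexity.matMulTensor ℂ n n n)
      (Nat.le_of_not_lt hle))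
  exact_mod_cast hlt

end Summit.MatrixMultiplication.MatrixMultiplication.Theses.SuccinctSecantEquations
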